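import Mathlib
import Summits.PneNP.PneNP.Theorems.ConvexRankGatesConvexGateBlindL1Linear

/-!
# PneNP / ConvexRankGates — `ConvexGateBlind`: the pool, degree and split weightings (towards two-weight clique decompositions)

Helpers (`--supports stmt-PneNP-10680`), COLUMN-SPACE line (prover seat 2, session 19). Three explicit non-negative weightings
of vertex sets and their EXACT pair marginals `∑_Q ω(Q)[x,y ∈ Q]` (`x ≠ y`):
 * `poolOmega` — the pool measure of `…PoolMeasure` as a weighting of `2r`-sets (`ω_P(Q) = E[Q' = Q]`); marginals
   `α_r(m) + β_r(m)·rc F(x,y)` (`sum_poolOmega_pair`);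
 * `degOmega g k` — the `k`-set `Q` weighted by `∑_{z∈Q} g z`; marginals `C(m−2,k−2)(g x + g y) + C(m−3,k−3)(∑g − g x − g y)`
   (`sum_degOmega_pair`);
 * `splitOmega ω k` — each `(k+1)`-set hands its weight to its `k`-subsets; marginals scale by `k − 1` (`sum_splitOmega_pair`).
`…TwoWeightDecomposition` mixes them into exact two-weight fractional `K_k`-decompositions of `K_m`. [new]
-/

set_option linter.dupNamespace false

namespace Summit.PneNP.PneNP.Theorems

open Finset

noncomputable section

variable {m : ℕ}

/-! ## The pool measure as a weighting of sets -/

/-- The pool measure as an explicit weighting: `ω_P(Q) = E_r[Q' = Q]`. [new] -/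
def poolOmega (η : ℝ) (n : ℕ) (F : Fin m → Fin m → ℝ) (r : ℕ) (Q : Finset (Fin m)) : ℝ :=
  poolE η n F r (Finset.univ : Finset (Fin m)) (fun Q' => if Q' = Q then 1 else 0)

variable (η : ℝ) (n : ℕ) (F : Fin m → Fin m → ℝ)

/-- The functional is integration against `ω_P`. [new] -/
theorem poolE_eq_sum_poolOmega (r : ℕ) (g : Finset (Fin m) → ℝ) :
    poolE η n F r (Finset.univ : Finset (Fin m)) g = ∑ Q, poolOmega η n F r Q * g Q := by
  classical
  have hg : g = fun Q' => ∑ Q, g Q * (if Q' = Q then (1 : ℝ) else 0) := by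
    funext Q'
    rw [Finset.sum_mul_boole]
    simp
  conv_lhs => rw [hg]
  rw [poolE_sum]
  refine Finset.sum_congr rfl fun Q _ => ?_
  rw [poolE_smul, mul_comm]
  rfl

/-- `ω_P ≥ 0` when the pair weights are non-negative. [new] -/
theorem poolOmega_nonneg (hν : ∀ (P : Finset (Fin m)) (a b : Fin m), P.card = n → a ∈ P → b ∈ P → 0 ≤ poolNu η n F P a b)
    (r : ℕ) (Q : Finset (Fin m)) : 0 ≤ poolOmega η n F r Q :=
  poolE_nonneg η n F hν r _ _ (fun Q' _ _ => by positivity)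

/-- `ω_P` lives on the `2r`-subsets. [new] -/
theorem poolOmega_eq_zero (r : ℕ) {Q : Finset (Fin m)} (hQ : Q.card ≠ 2 * r) : poolOmega η n F r Q = 0 := by
  unfold poolOmega
  rw [poolE_congr_on η n F r Finset.univ _ (fun _ => (0 : ℝ)) (fun Q' _ hQ' => by
    rw [if_neg]; rintro rfl; exact hQ hQ')]
  have h := poolE_smul η n F r (Finset.univ : Finset (Fin m)) 0 (fun _ => (0 : ℝ))
  simp only [zero_mul] at h
  exact h

/-- **Pair marginals of `ω_P`:** `∑_Q ω_P(Q)[x,y ∈ Q] = α_r(m) + β_r(m)·rc F(x,y)` (`x ≠ y`, `4 ≤ n`, `n·r ≤ m`). [new] -/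
theorem sum_poolOmega_pair (hF : ∀ a b, F a b = F b a) (hn : 4 ≤ n) (r : ℕ) (hnr : n * r ≤ m) {x y : Fin m} (hxy : x ≠ y) :
    ∑ Q, poolOmega η n F r Q * (if x ∈ Q ∧ y ∈ Q then (1 : ℝ) else 0) =
      poolAlpha r m + poolBeta η n r m * poolRc (Finset.univ : Finset (Fin m)) F x y := by
  have hU : n * r ≤ (Finset.univ : Finset (Fin m)).card := by rwa [Finset.card_univ, Fintype.card_fin]
  rw [← poolE_eq_sum_poolOmega, poolE_pair η n F hF hn hxy r _ hU, if_pos ⟨Finset.mem_univ x, Finset.mem_univ y⟩,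
    Finset.card_univ, Fintype.card_fin]

/-! ## The degree measure -/

/-- The degree measure: the `k`-set `Q` gets weight `∑_{z∈Q} g z`. [new] -/
def degOmega (g : Fin m → ℝ) (k : ℕ) (Q : Finset (Fin m)) : ℝ := if Q.card = k then ∑ z ∈ Q, g z else 0

/-- **Pair marginals of the degree measure:** `C(m−2,k−2)(g x + g y) + C(m−3,k−3)(∑g − g x − g y)` (`x ≠ y`, `3 ≤ k`). [new] -/
theorem sum_degOmega_pair (g : Fin m → ℝ) {k : ℕ} (hk : 3 ≤ k) {x y : Fin m} (hxy : x ≠ y) :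
    ∑ Q, degOmega g k Q * (if x ∈ Q ∧ y ∈ Q then (1 : ℝ) else 0) =
      ((m - 2).choose (k - 2) : ℝ) * (g x + g y) + ((m - 3).choose (k - 3) : ℝ) * (∑ z, g z - g x - g y) := by
  classical
  -- restrict to `k`-sets through `x, y`
  set 𝓠 := ((Finset.univ : Finset (Fin m)).powersetCard k).filter (fun Q => x ∈ Q ∧ y ∈ Q) with h𝓠
  have hrestrict : ∑ Q, degOmega g k Q * (if x ∈ Q ∧ y ∈ Q then (1 : ℝ) else 0) = ∑ Q ∈ 𝓠, ∑ z ∈ Q, g z := by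
    rw [h𝓠, Finset.sum_filter]
    have huniv : (Finset.univ : Finset (Fin m)).powersetCard k = Finset.univ.filter (fun Q : Finset (Fin m) => Q.card = k) := by
      ext Q; simp [Finset.mem_powersetCard]
    rw [huniv, Finset.sum_filter]
    refine Finset.sum_congr rfl fun Q _ => ?_
    unfold degOmega
    by_cases hc : Q.card = k <;> by_cases hm : x ∈ Q ∧ y ∈ Q <;> simp [hc, hm]
  rw [hrestrict]
  -- swap: `∑_{Q ∈ 𝓠} ∑_{z ∈ Q} g z = ∑_z g z · #{Q ∈ 𝓠 : z ∈ Q}`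
  have hswap : ∑ Q ∈ 𝓠, ∑ z ∈ Q, g z = ∑ z, g z * ((𝓠.filter (fun Q => z ∈ Q)).card : ℝ) := by
    have h1 : ∀ Q ∈ 𝓠, ∑ z ∈ Q, g z = ∑ z, if z ∈ Q then g z else 0 := by
      intro Q _; rw [← Finset.sum_filter]; congr 1; ext z; simp
    rw [Finset.sum_congr rfl h1, Finset.sum_comm]
    refine Finset.sum_congr rfl fun z _ => ?_
    rw [← Finset.sum_filter, Finset.sum_const, nsmul_eq_mul, mul_comm]
  rw [hswap]
  -- counts
  have hxy2 : ({x, y} : Finset (Fin m)).card = 2 := by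
    rw [Finset.card_insert_of_notMem (by simpa using hxy), Finset.card_singleton]
  have hcard_univ : (Finset.univ : Finset (Fin m)).card = m := by rw [Finset.card_univ, Fintype.card_fin]
  have hcount_marked : ∀ z, z = x ∨ z = y → ((𝓠.filter (fun Q => z ∈ Q)).card : ℝ) = ((m - 2).choose (k - 2) : ℝ) := by
    intro z hz
    have hf : 𝓠.filter (fun Q => z ∈ Q) = ((Finset.univ : Finset (Fin m)).powersetCard k).filter
        (fun Q => ({x, y} : Finset (Fin m)) ⊆ Q) := by
      rw [h𝓠, Finset.filter_filter]
      refine Finset.filter_congr (fun Q _ => ?_)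
      rcases hz with rfl | rfl
      · simp [Finset.insert_subset_iff]; tauto
      · simp [Finset.insert_subset_iff]
    rw [hf]
    have h := rb_card_filter_powersetCard_superset (B := {x, y}) (U := (Finset.univ : Finset (Fin m)))
      (Finset.subset_univ _) (c := k) (by rw [hxy2]; omega)
    rw [hcard_univ, hxy2] at h
    exact_mod_cast h
  have hcount_free : ∀ z, z ≠ x → z ≠ y → ((𝓠.filter (fun Q => z ∈ Q)).card : ℝ) = ((m - 3).choose (k - 3) : ℝ) := by
    intro z hzx hzy
    have h3 : ({x, y, z} : Finset (Fin m)).card = 3 := by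
      rw [Finset.card_insert_of_notMem (by simp [hxy, Ne.symm hzx]), Finset.card_insert_of_notMem (by simpa using Ne.symm hzy),
        Finset.card_singleton]
    have hf : 𝓠.filter (fun Q => z ∈ Q) = ((Finset.univ : Finset (Fin m)).powersetCard k).filter
        (fun Q => ({x, y, z} : Finset (Fin m)) ⊆ Q) := by
      rw [h𝓠, Finset.filter_filter]
      refine Finset.filter_congr (fun Q _ => ?_)
      simp [Finset.insert_subset_iff, and_assoc]
    rw [hf]
    have h := rb_card_filter_powersetCard_superset (B := {x, y, z}) (U := (Finset.univ : Finset (Fin m)))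
      (Finset.subset_univ _) (c := k) (by rw [h3]; omega)
    rw [hcard_univ, h3] at h
    exact_mod_cast h
  -- evaluate the weighted count
  have hpt : ∀ z, g z * ((𝓠.filter (fun Q => z ∈ Q)).card : ℝ) =
      ((m - 3).choose (k - 3) : ℝ) * g z +
        (((m - 2).choose (k - 2) : ℝ) - ((m - 3).choose (k - 3) : ℝ)) * (g z * (if z = x then 1 else 0) + g z * (if z = y then 1 else 0)) := by
    intro z
    by_cases hzx : z = x
    · subst hzx; rw [hcount_marked z (Or.inl rfl), if_pos rfl, if_neg hxy]; ring
    · by_cases hzy : z = y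
      · subst hzy; rw [hcount_marked z (Or.inr rfl), if_neg hzx, if_pos rfl]; ring
      · rw [hcount_free z hzx hzy, if_neg hzx, if_neg hzy]; ring
  rw [Finset.sum_congr rfl (fun z _ => hpt z), Finset.sum_add_distrib, ← Finset.mul_sum, ← Finset.mul_sum,
    Finset.sum_add_distrib]
  simp_rw [mul_boole]
  rw [Finset.sum_ite_eq', Finset.sum_ite_eq']
  simp only [Finset.mem_univ, if_true]
  ring

/-- The degree measure is non-negative for `g ≥ 0` and lives on `k`-sets. [new] -/
theorem degOmega_nonneg (g : Fin m → ℝ) (hg : ∀ z, 0 ≤ g z) (k : ℕ) (Q : Finset (Fin m)) : 0 ≤ degOmega g k Q := by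
  unfold degOmega; split_ifs
  · exact Finset.sum_nonneg fun z _ => hg z
  · exact le_rfl

/-! ## Splitting `(k+1)`-sets into `k`-sets (odd `k`) -/

/-- Splitting: the `k`-set `Q` receives `∑_{z ∉ Q} ω(Q ∪ {z})`. [new] -/
def splitOmega (ω : Finset (Fin m) → ℝ) (k : ℕ) (Q : Finset (Fin m)) : ℝ :=
  if Q.card = k then ∑ z ∈ Finset.univ \ Q, ω (insert z Q) else 0

/-- Reindexing `Q ↦ Q ∪ {z}` between the sets avoiding `z` and the sets through `z`. [folklore] -/
theorem sum_filter_not_mem_insert (z : Fin m) (f : Finset (Fin m) → ℝ) :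
    ∑ Q ∈ (Finset.univ : Finset (Finset (Fin m))).filter (fun Q => z ∉ Q), f (insert z Q) =
      ∑ Q ∈ (Finset.univ : Finset (Finset (Fin m))).filter (fun Q => z ∈ Q), f Q := by
  classical
  refine Finset.sum_nbij' (fun Q => insert z Q) (fun Q => Q.erase z) (fun Q hQ => ?_) (fun Q hQ => ?_)
    (fun Q hQ => ?_) (fun Q hQ => ?_) (fun Q _ => rfl)
  · simp only [Finset.mem_filter, Finset.mem_univ, true_and] at hQ ⊢
    exact Finset.mem_insert_self z Q
  · simp only [Finset.mem_filter, Finset.mem_univ, true_and] at hQ ⊢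
    exact Finset.notMem_erase z Q
  · simp only [Finset.mem_filter, Finset.mem_univ, true_and] at hQ
    exact Finset.erase_insert hQ
  · simp only [Finset.mem_filter, Finset.mem_univ, true_and] at hQ
    exact Finset.insert_erase hQ

/-- **Splitting preserves pair marginals up to the factor `k − 1`:** if `ω` lives on `(k+1)`-sets then
`∑_Q split(ω)(Q)[x,y ∈ Q] = (k−1)·∑_Q ω(Q)[x,y ∈ Q]` (`x ≠ y`). [new] -/
theorem sum_splitOmega_pair (ω : Finset (Fin m) → ℝ) {k : ℕ} (hω : ∀ Q, ω Q ≠ 0 → Q.card = k + 1) {x y : Fin m}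
    (hxy : x ≠ y) :
    ∑ Q, splitOmega ω k Q * (if x ∈ Q ∧ y ∈ Q then (1 : ℝ) else 0) =
      ((k : ℝ) - 1) * ∑ Q, ω Q * (if x ∈ Q ∧ y ∈ Q then (1 : ℝ) else 0) := by
  classical
  -- expand the split weighting as a double sum over `(Q, z)` with `z ∉ Q`
  have hL : ∑ Q, splitOmega ω k Q * (if x ∈ Q ∧ y ∈ Q then (1 : ℝ) else 0) =
      ∑ z, ∑ Q ∈ (Finset.univ : Finset (Finset (Fin m))).filter (fun Q => z ∉ Q),
        (if (insert z Q).card = k + 1 then ω (insert z Q) else 0) *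
          (if x ∈ (insert z Q).erase z ∧ y ∈ (insert z Q).erase z then (1 : ℝ) else 0) := by
    have h1 : ∀ Q : Finset (Fin m), splitOmega ω k Q * (if x ∈ Q ∧ y ∈ Q then (1 : ℝ) else 0) =
        ∑ z, (if z ∉ Q then (if (insert z Q).card = k + 1 then ω (insert z Q) else 0) *
          (if x ∈ (insert z Q).erase z ∧ y ∈ (insert z Q).erase z then (1 : ℝ) else 0) else 0) := by
      intro Q
      unfold splitOmega
      by_cases hc : Q.card = k
      · rw [if_pos hc, Finset.sum_mul]
        symm
        rw [← Finset.sum_filter]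
        have huniv : Finset.univ.filter (fun z => z ∉ Q) = Finset.univ \ Q := by ext z; simp
        rw [huniv]
        refine Finset.sum_congr rfl fun z hz => ?_
        have hz' : z ∉ Q := (Finset.mem_sdiff.1 hz).2
        rw [if_pos (by rw [Finset.card_insert_of_notMem hz', hc]), Finset.erase_insert hz']
      · rw [if_neg hc, zero_mul]
        refine (Finset.sum_eq_zero fun z _ => ?_).symm
        by_cases hz : z ∉ Q
        · rw [if_pos hz]
          have : (insert z Q).card ≠ k + 1 := by rw [Finset.card_insert_of_notMem hz]; omega
          rw [if_neg this, zero_mul]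
        · rw [if_neg hz]
    rw [Finset.sum_congr rfl (fun Q _ => h1 Q), Finset.sum_comm]
    refine Finset.sum_congr rfl fun z _ => ?_
    rw [Finset.sum_filter]
  rw [hL, Finset.sum_congr rfl (fun z _ => sum_filter_not_mem_insert z (fun Q' =>
    (if Q'.card = k + 1 then ω Q' else 0) * (if x ∈ Q'.erase z ∧ y ∈ Q'.erase z then (1 : ℝ) else 0)))]
  -- now a sum over `(z, Q')` with `z ∈ Q'`
  have hR : ∀ z, ∑ Q' ∈ (Finset.univ : Finset (Finset (Fin m))).filter (fun Q' => z ∈ Q'),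
      (if Q'.card = k + 1 then ω Q' else 0) * (if x ∈ Q'.erase z ∧ y ∈ Q'.erase z then (1 : ℝ) else 0) =
      ∑ Q', ω Q' * (if z ∈ Q' ∧ z ≠ x ∧ z ≠ y then (if x ∈ Q' ∧ y ∈ Q' then (1 : ℝ) else 0) else 0) := by
    intro z
    rw [Finset.sum_filter]
    refine Finset.sum_congr rfl fun Q' _ => ?_
    by_cases hz : z ∈ Q'
    · rw [if_pos hz]
      by_cases hω0 : ω Q' = 0
      · rw [hω0]; simp
      · rw [if_pos (hω Q' hω0)]
        simp only [Finset.mem_erase, ne_eq]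
        by_cases hzx : z = x
        · subst hzx; simp
        · by_cases hzy : z = y
          · subst hzy; simp
          · simp [hzx, hzy, Ne.symm hzx, Ne.symm hzy, hz]
    · rw [if_neg hz, if_neg (fun h => hz h.1), mul_zero]
  rw [Finset.sum_congr rfl (fun z _ => hR z), Finset.sum_comm, Finset.mul_sum]
  refine Finset.sum_congr rfl fun Q' _ => ?_
  rw [← Finset.mul_sum]
  by_cases hω0 : ω Q' = 0
  · rw [hω0]; ring
  have hcard := hω Q' hω0
  by_cases hxyQ : x ∈ Q' ∧ y ∈ Q'
  · rw [if_pos hxyQ]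
    have hcount : ∑ z, (if z ∈ Q' ∧ z ≠ x ∧ z ≠ y then (1 : ℝ) else 0) = (k : ℝ) - 1 := by
      rw [Finset.sum_boole]
      have hf : Finset.univ.filter (fun z => z ∈ Q' ∧ z ≠ x ∧ z ≠ y) = (Q'.erase x).erase y := by
        ext z; simp [Finset.mem_erase]; tauto
      rw [hf, Finset.card_erase_of_mem (Finset.mem_erase.2 ⟨Ne.symm hxy, hxyQ.2⟩), Finset.card_erase_of_mem hxyQ.1, hcard]
      have hk1 : 1 ≤ k := by
        have : ({x, y} : Finset (Fin m)) ⊆ Q' := by simp [Finset.insert_subset_iff, hxyQ.1, hxyQ.2]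
        have hc2 := Finset.card_le_card this
        rw [Finset.card_insert_of_notMem (by simpa using hxy), Finset.card_singleton, hcard] at hc2
        omega
      rw [show k + 1 - 1 - 1 = k - 1 from by omega, Nat.cast_sub hk1]
      push_cast
      ring
    simp_rw [mul_one]
    rw [hcount]; ring
  · rw [if_neg hxyQ]
    simp

/-- `split(ω) ≥ 0` for `ω ≥ 0`, and it lives on `k`-sets. [new] -/
theorem splitOmega_nonneg (ω : Finset (Fin m) → ℝ) (hω : ∀ Q, 0 ≤ ω Q) (k : ℕ) (Q : Finset (Fin m)) :
    0 ≤ splitOmega ω k Q := by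
  unfold splitOmega; split_ifs
  · exact Finset.sum_nonneg fun z _ => hω _
  · exact le_rfl


/-- **Splitting preserves pair marginals** (registered form of `sum_splitOmega_pair`). [new] -/
theorem split_pair_marginal : ∀ {m : ℕ} (ω : Finset (Fin m) → ℝ) {k : ℕ}, (∀ Q, ω Q ≠ 0 → Q.card = k + 1) → ∀ {x y : Fin m}, x ≠ y → ∑ Q, splitOmega ω k Q * (if x ∈ Q ∧ y ∈ Q then (1 : ℝ) else 0) = ((k : ℝ) - 1) * ∑ Q, ω Q * (if x ∈ Q ∧ y ∈ Q then (1 : ℝ) else 0) :=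
  fun ω _ hω _ _ hxy => sum_splitOmega_pair ω hω hxy

end

end Summit.PneNP.PneNP.Theorems
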